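/-
Copyright: the b2b-balaban T⁴-continuum CRUX team, row NE7b OWNER lineage `t4-ne7b-p1` (gen 120). Project licence.
-/
import Summits.QuantumFields.BalabanUV.T4Continuum.Spine.NE7b.SupTorusSchurComplement

/-!
# THE COARSE FLOOR AND THE END OF THE LOCALITY COLUMN: for `H = (n+1)²(−Δ) + a(n+1)^{−d}(block sums) + V` with `−λ ≤ V ≤ Λ`,
# `λ ≤ min(2,a)`, `a > 0`, the Schur complement `T = Q′tH⁻¹Q′t*` has the floor `⟨g, Tg⟩ ≥ Σg²∕(36^d(4d + a + Λ))` on EVERY pair of tori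
# — [B6] (2.76)'s torus twin with a bounded potential, by the variational inequality and `B6QGQLower276`'s tapered block bump read on
# window representatives — HENCE, UNCONDITIONALLY: the next-scale Hessian `W″ = (n+1)^d T⁻¹` of the torus road is EXPONENTIALLY LOCAL
# on the coarse torus with constants depending on `(d, a, λ, Λ)` only — every field of the two-sided class, every mesh, every volume
# (row NE7b, node U5c; (130)–(134) + `B6QGQLower276` + `B4Sect5Torus` BY NAME; [folklore])

Cell `pub-balaban`, sub-cell `t4`, spine estimate NE7b (`T4WeightBudget.RelWeightBound`; the cell's OWN estimate — NOT PRINTED in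
[Bałaban 1983–89], NOT PROVED).  Crux-route work under `Spine/NE7b/` by the row OWNER (`t4-ne7b-p1` gen 120, file (135)) under FREEZE
(0)'s crux-prover clause — discharging (134)'s one hypothesis (the coarse floor) and closing the located dead end «mesh-UNIFORM locality»
(OWNER g118 HANDOFF) for the road's next-scale Hessian; NOTHING of Bałaban's is named as a Lean object, valued or asserted; no
`T4Continuum/Support` leaf typed; no `def`, no notation; zero `sorry`.  Imports (BY NAME): the OWNER's (134) `…SupTorusSchurComplement`
(`schur_inverse_decay`; through it (133) `action_form_symm`, `action_sum_smul`, `action_sub`, `sum_indicator_mul`, (131) `exists_rate`,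
(130) `torus_form_split`, `sum_translate`, (89) TDFC `torus_form_coercive_explicit`, TDF `sum_blockLift_mul`, `blockOf_siteOf`,
`loc_add_side_smul`, (55) `blk_translate`, PTC `exists_windowMap_siteOf` ∕ `siteOf_add_smul` ∕ `natCast_mul_smul_eq`), the Literature column
`B6QGQLower276` §6–§7 (`bump`, `bump_nonneg`, `bump_le_one`, **`F`**, **`F_step_sq`**, `Theta1`, `Theta1_div_ge`, `Theta1_div_le`, `sum_B_bump`).

WHY (located).  (134) `schur_inverse_decay` localises `T⁻¹` GIVEN `⟨g,Tg⟩ ≥ γΣg²` with `γ` mesh-free.  In displayed terms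
`⟨g, Tg⟩ = (n+1)^{−d}·Σ_x G·Ψ` with `G = g∘bt` the block-constant lift and `Ψ = Σ_{y′} g(y′)ψ_{y′}` the solution of `HΨ = G`; for ANY test
function `Φ` and `t`, `Σ GΨ ≥ 2tΣ GΦ − t²Σ Φ·HΦ` (the form of `H` is `≥ 0` on `Ψ − tΦ` since `λ ≤ min(2,a)`, and symmetric).  The test
function is [B6]'s: `Φ(x) = g(bt x)·bump(wm x)`, the product of parabolic profiles tapering to `1∕(n+1)` at the block faces, so that
`Σ GΦ = Θ₁^dΣg²` with `Θ₁ ≥ (n+1)∕6`, while `Σ Φ·HΦ ≤ (4d + a + Λ)(n+1)^dΣg²`: the Laplacian part from `F_step_sq` pointwise on window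
representatives and — instead of the block-boundary case split — the identity `Σ_x g(bt(x + ê_μ))² = Σ_x g(bt x)²` (translation invariance
of the torus sum); the block part is `a(n+1)^{−d}Θ₁^{2d}Σg² ≤ a(n+1)^dΣg²`; the potential part `≤ Λ(n+1)^dΣg²` (`bump ≤ 1`).  Optimising
`t = 6^{−d}∕(4d + a + Λ)` gives the floor `γ = 1∕(36^d(4d + a + Λ))` — print's `2γ₀` of (2.76) in our constants, now WITH a bounded
potential and ON THE TORUS.  With (131) `exists_rate` for `κ` the headline has no hypothesis beyond `a > 0`, `λ < min(2,a)`, `Λ ≥ 0`.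

WHAT IS PROVED ([folklore]; fine torus `Site d ((n+1)s)`, coarse `Site d s`, `[NeZero s]`; `F = B6QGQLower276.F n (g ∘ σ_s)`; `bt x =
σ_s(blk n (wm x))`; the action DISPLAYED; `T(y,y′) = (n+1)^{−d}Σ_z ψ_{y′}(σ(chart n (wm y) z))` for columns `Hψ_{y′} = 𝟙[bt · = y′]`):
* §1 `bump_add_side_smul`, `F_add_period_smul` (`F` is `(n+1)s`-periodic), `F_windowMap_siteOf`, `F_windowMap_add` (a torus bond step is a
  lattice bond step on representatives), `sum_sq_blockLift` (`Σ_x g(bt x)² = (n+1)^dΣg²`), **`sum_blockLift_mul_F`**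
  (`Σ_x g(bt x)F(wm x) = Θ₁^dΣg²`), `blockSum_F`, **`sum_bond_sq_le`** (`Σ_x (F(wm(x+ê_μ)) − F(wm x))² ≤ 4(n+1)^{d−2}Σg²`), `sum_F_sq_le`.
* §2 `action_smul`, **`variational`** (`HΨ = G`, `λ ≤ min(2,a)` ⟹ `2tΣGΦ − t²ΣΦ·HΦ ≤ ΣGΨ`), **`coarse_floor`** (`a > 0`, `−λ ≤ V ≤ Λ`,
  `λ ≤ min(2,a)`: `Σg²∕(36^d(4d + a + Λ)) ≤ Σ_y g y Σ_{y′} T(y,y′) g y′` — (134)'s hypothesis, discharged).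
* §3 THE HEADLINE **`nextScale_hessian_local`**: `∃ c₁ δ₁ > 0` depending on `(d, a, λ, Λ)` ONLY such that for ALL `n, s`, all
  `−λ ≤ V ≤ Λ`, all block columns `ψ`: `|T⁻¹(y,y′)| ≤ c₁e^{−δ₁ρ_s(y,y′)}` (`ρ_s` = (132)'s `ℓ¹` circular distance).
* §4 toy.

HONEST (what this is NOT).  The TWO-SIDED class (`u′ ≤ Λ`; `φ⁴` needs a polynomial-growth ceiling, not here); `T⁻¹` is localised — the
response `DΦ = H⁻¹Q′t*T⁻¹` and the fluctuation covariance follow by (131) + convolution but are NOT typed here (block-`ℓ²` currency; a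
pointwise sup statement would carry `(n+1)^{d∕2}` without an `ℓ^∞` theory); the identification `W″ = (n+1)^d T⁻¹` with (102)'s Hessian
is by the road's displays ((100) `Q′t∘DΦ = 1`, `H∘DΦ` block-constant), not re-proved here; constants explicit, far from sharp; cubic
periods; scalar skeleton ((A3), NC-NE7b-α UNRULED); nothing of the covariant propagators; nothing of Bałaban's.  BY-NAME EFFECT ON THE
WALL: NONE.  NE7b NOT PRINTED ∕ NOT PROVED; spine PROVED 0∕9; rung (B)+1 on a FINITE torus — NOT infinite volume, NOT the mass gap,
NOT Clay.  HONEST DEPENDENCY: continuum YM on T⁴ ⇐ BetaPertH ∧ nine spine estimates (0∕9 proved); BetaPertH ⇐ (D1) ∧ (D4) ∧ CAP+tail;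
G-an2-4 gates asym, D1 and NE2∕3∕4.
-/

set_option autoImplicit false

noncomputable section

namespace Summit.QuantumFields.BalabanUV.T4Continuum.NE7b.SupTorusCoarseFloor

open Real
open Literature.MathematicalPhysics.QuantumFieldTheory.Balaban1983to89
open B6QGQLower276 (X e blk B side chart mem_B sum_B sum_B_const card_cube blk_chart bump bump_nonneg bump_le_one F F_step_sq
  Theta1 Theta1_div_ge Theta1_div_le Theta1_nonneg sum_B_bump loc)
open Beta (Site siteOf windowMap siteOf_windowMap siteOf_add)
open SupTorusDirichletForm (sum_fine_eq_sum_blocks sum_blockLift_mul blockOf_siteOf_of_mem loc_add_side_smul)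
open OneShotChartTorusRowsZd (blk_translate)
open PeriodicSupTorusCarrier (exists_windowMap_siteOf siteOf_add_smul natCast_mul_smul_eq)
open SupTorusConjugatedForm (sum_translate torus_form_split)
open SupTorusDirichletFormCoercive (torus_form_coercive_explicit)
open SupTorusActionForm (action_form_symm action_sum_smul action_sub sum_indicator_mul)
open SupTorusSchurComplement (schur_inverse_decay)

variable {d : ℕ}

/-! ## §1. The periodic bump test function on the fine torus, read on window representatives -/

section Bump

variable (n s : ℕ) [NeZero s]

/-- The bump is periodic under block-lattice translations (its local coordinates are). [folklore] -/
theorem bump_add_side_smul (p t : X d) : bump n (p + side n • t) = bump n p := by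
  unfold bump
  exact Finset.prod_congr rfl fun μ _ => by rw [loc_add_side_smul]

omit [NeZero s] in
/-- **THE TEST FUNCTION `F(p) = g(σ_s(blk p))·bump(p)` IS `(n+1)s`-PERIODIC** (coarse profile `g` on the coarse torus). [folklore] -/
theorem F_add_period_smul (g : Site d s → ℝ) (p m : X d) :
    F n (fun q => g (siteOf d s q)) (p + (((n + 1) * s : ℕ) : ℤ) • m) = F n (fun q => g (siteOf d s q)) p := by
  simp only [F]
  rw [natCast_mul_smul_eq, blk_translate, bump_add_side_smul, siteOf_add_smul]

/-- Reading `F` at the window representative of a periodised site: `F(wm(σ q)) = F(q)`. [folklore] -/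
theorem F_windowMap_siteOf (g : Site d s → ℝ) (q : X d) :
    F n (fun q => g (siteOf d s q)) (windowMap d ((n + 1) * s) (siteOf d ((n + 1) * s) q)) = F n (fun q => g (siteOf d s q)) q := by
  obtain ⟨m, hm⟩ := exists_windowMap_siteOf ((n + 1) * s) q
  rw [hm, F_add_period_smul]

/-- A torus bond step is a lattice bond step on representatives: `F(wm(x + ê_μ)) = F(wm x + e_μ)`. [folklore] -/
theorem F_windowMap_add (g : Site d s → ℝ) (x : Site d ((n + 1) * s)) (μ : Fin d) :
    F n (fun q => g (siteOf d s q)) (windowMap d ((n + 1) * s) (x + siteOf d ((n + 1) * s) (e μ)))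
      = F n (fun q => g (siteOf d s q)) (windowMap d ((n + 1) * s) x + e μ) := by
  have hx : x + siteOf d ((n + 1) * s) (e μ) = siteOf d ((n + 1) * s) (windowMap d ((n + 1) * s) x + e μ) := by
    rw [siteOf_add, siteOf_windowMap]
  rw [hx, F_windowMap_siteOf]

/-- `Σ_x g(bt x)² = (n+1)^d·Σ_y g y²`. [folklore] -/
theorem sum_sq_blockLift (g : Site d s → ℝ) :
    ∑ x : Site d ((n + 1) * s), g (siteOf d s (blk n (windowMap d ((n + 1) * s) x))) ^ 2 = ((n : ℝ) + 1) ^ d * ∑ y, g y ^ 2 := by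
  have h := sum_blockLift_mul n s g (fun x => g (siteOf d s (blk n (windowMap d ((n + 1) * s) x))))
  simp only [← sq] at h
  rw [h, Finset.mul_sum]
  refine Finset.sum_congr rfl fun y _ => ?_
  rw [Finset.sum_congr rfl fun p hp => by rw [blockOf_siteOf_of_mem n s hp], sum_B_const]
  ring

/-- **THE PAIRING OF THE BLOCK-CONSTANT LIFT WITH THE TEST FUNCTION**: `Σ_x g(bt x)·F(wm x) = Θ₁^d·Σ_y g y²`. [folklore] -/
theorem sum_blockLift_mul_F (g : Site d s → ℝ) :
    ∑ x : Site d ((n + 1) * s), g (siteOf d s (blk n (windowMap d ((n + 1) * s) x))) * F n (fun q => g (siteOf d s q)) (windowMap d ((n + 1) * s) x)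
      = Theta1 n ^ d * ∑ y, g y ^ 2 := by
  rw [sum_blockLift_mul n s g, Finset.mul_sum]
  refine Finset.sum_congr rfl fun y _ => ?_
  simp only [F_windowMap_siteOf]
  rw [Finset.sum_congr rfl fun p hp => by simp only [F]; rw [mem_B.1 hp, siteOf_windowMap], ← Finset.mul_sum, sum_B_bump]
  ring

/-- The block sum of the test function: `Σ_z F(wm(σ(chart (wm y) z))) = g y·Θ₁^d`. [folklore] -/
theorem blockSum_F (g : Site d s → ℝ) (y : Site d s) :
    ∑ z : Fin d → Fin (n + 1), F n (fun q => g (siteOf d s q)) (windowMap d ((n + 1) * s) (siteOf d ((n + 1) * s) (chart n (windowMap d s y) z)))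
      = g y * Theta1 n ^ d := by
  rw [← sum_B (windowMap d s y) (fun p => F n (fun q => g (siteOf d s q)) (windowMap d ((n + 1) * s) (siteOf d ((n + 1) * s) p)))]
  simp only [F_windowMap_siteOf]
  rw [Finset.sum_congr rfl fun p hp => by simp only [F]; rw [mem_B.1 hp, siteOf_windowMap], ← Finset.mul_sum, sum_B_bump]

/-- **THE DIRICHLET FORM OF THE TEST FUNCTION, ONE DIRECTION**: `Σ_x (F(wm(x+ê_μ)) − F(wm x))² ≤ 4(n+1)^{d−2}·Σ_y g y²` — `F_step_sq` pointwise,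
and `Σ_x g(bt(x + ê_μ))² = Σ_x g(bt x)²` by translation (no block-boundary case split). [folklore] -/
theorem sum_bond_sq_le (g : Site d s → ℝ) (μ : Fin d) :
    ∑ x : Site d ((n + 1) * s), (F n (fun q => g (siteOf d s q)) (windowMap d ((n + 1) * s) (x + siteOf d ((n + 1) * s) (e μ)))
        - F n (fun q => g (siteOf d s q)) (windowMap d ((n + 1) * s) x)) ^ 2
      ≤ 4 * ((n : ℝ) + 1) ^ d / ((n : ℝ) + 1) ^ 2 * ∑ y, g y ^ 2 := by
  have hs1 : (0 : ℝ) < (n : ℝ) + 1 := by positivity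
  -- translation: the shifted block profile has the same sum of squares
  have htr : ∑ x : Site d ((n + 1) * s), g (siteOf d s (blk n (windowMap d ((n + 1) * s) x + e μ))) ^ 2
      = ((n : ℝ) + 1) ^ d * ∑ y, g y ^ 2 := by
    have h1 : ∀ x : Site d ((n + 1) * s), g (siteOf d s (blk n (windowMap d ((n + 1) * s) x + e μ)))
        = g (siteOf d s (blk n (windowMap d ((n + 1) * s) (x + siteOf d ((n + 1) * s) (e μ))))) := fun x => by
      rw [show x + siteOf d ((n + 1) * s) (e μ) = siteOf d ((n + 1) * s) (windowMap d ((n + 1) * s) x + e μ) by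
        rw [siteOf_add, siteOf_windowMap], SupTorusDirichletForm.blockOf_siteOf]
    simp only [h1]
    rw [SupTorusConjugatedForm.sum_translate (siteOf d ((n + 1) * s) (e μ)) (fun x => g (siteOf d s (blk n (windowMap d ((n + 1) * s) x))) ^ 2)]
    exact sum_sq_blockLift n s g
  calc ∑ x : Site d ((n + 1) * s), (F n (fun q => g (siteOf d s q)) (windowMap d ((n + 1) * s) (x + siteOf d ((n + 1) * s) (e μ)))
          - F n (fun q => g (siteOf d s q)) (windowMap d ((n + 1) * s) x)) ^ 2
      ≤ ∑ x : Site d ((n + 1) * s), 2 * (g (siteOf d s (blk n (windowMap d ((n + 1) * s) x))) ^ 2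
          + g (siteOf d s (blk n (windowMap d ((n + 1) * s) x + e μ))) ^ 2) / ((n : ℝ) + 1) ^ 2 := by
        refine Finset.sum_le_sum fun x _ => ?_
        rw [F_windowMap_add, ← neg_sub, neg_sq]
        exact F_step_sq n (fun q => g (siteOf d s q)) (windowMap d ((n + 1) * s) x) μ
    _ = 4 * ((n : ℝ) + 1) ^ d / ((n : ℝ) + 1) ^ 2 * ∑ y, g y ^ 2 := by
        rw [← Finset.sum_div, ← Finset.mul_sum, Finset.sum_add_distrib, sum_sq_blockLift n s g, htr]
        ring

/-- `Σ_x F(wm x)² ≤ (n+1)^d·Σ_y g y²` (`0 ≤ bump ≤ 1`). [folklore] -/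
theorem sum_F_sq_le (g : Site d s → ℝ) :
    ∑ x : Site d ((n + 1) * s), F n (fun q => g (siteOf d s q)) (windowMap d ((n + 1) * s) x) ^ 2 ≤ ((n : ℝ) + 1) ^ d * ∑ y, g y ^ 2 := by
  rw [← sum_sq_blockLift n s g]
  refine Finset.sum_le_sum fun x _ => ?_
  rw [show F n (fun q => g (siteOf d s q)) (windowMap d ((n + 1) * s) x)
    = g (siteOf d s (blk n (windowMap d ((n + 1) * s) x))) * bump n (windowMap d ((n + 1) * s) x) from rfl, mul_pow]
  have : bump n (windowMap d ((n + 1) * s) x) ^ 2 ≤ 1 := by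
    nlinarith [bump_nonneg n (windowMap d ((n + 1) * s) x), bump_le_one n (windowMap d ((n + 1) * s) x)]
  exact (mul_le_mul_of_nonneg_left this (sq_nonneg _)).trans (le_of_eq (mul_one _))

end Bump

/-! ## §2. The coarse floor: `⟨g, Tg⟩ ≥ Σ g²∕(36^d(4d + a + Λ))` for `−λ ≤ V ≤ Λ`, every mesh, every volume -/

section Floor

variable (n : ℕ) (a : ℝ) (s : ℕ) [NeZero s]

/-- The displayed action is homogeneous: `H(c·u) = c·Hu` pointwise. [folklore] -/
theorem action_smul (V u : Site d ((n + 1) * s) → ℝ) (c : ℝ) (x : Site d ((n + 1) * s)) :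
    ((n : ℝ) + 1) ^ 2 * ∑ μ, (2 * (c * u x) - c * u (x + siteOf d ((n + 1) * s) (e μ)) - c * u (x - siteOf d ((n + 1) * s) (e μ)))
        + a / ((n : ℝ) + 1) ^ d * ∑ q ∈ B n (blk n (windowMap d ((n + 1) * s) x)), c * u (siteOf d ((n + 1) * s) q) + V x * (c * u x)
      = c * (((n : ℝ) + 1) ^ 2 * ∑ μ, (2 * u x - u (x + siteOf d ((n + 1) * s) (e μ)) - u (x - siteOf d ((n + 1) * s) (e μ)))
        + a / ((n : ℝ) + 1) ^ d * ∑ q ∈ B n (blk n (windowMap d ((n + 1) * s) x)), u (siteOf d ((n + 1) * s) q) + V x * u x) := by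
  rw [← Finset.mul_sum, show ∑ μ : Fin d, (2 * (c * u x) - c * u (x + siteOf d ((n + 1) * s) (e μ)) - c * u (x - siteOf d ((n + 1) * s) (e μ)))
      = c * ∑ μ : Fin d, (2 * u x - u (x + siteOf d ((n + 1) * s) (e μ)) - u (x - siteOf d ((n + 1) * s) (e μ))) by
    rw [Finset.mul_sum]; exact Finset.sum_congr rfl fun μ _ => by ring]
  ring

/-- **THE VARIATIONAL INEQUALITY**: if `HΨ = G` (displayed action, `V ≥ −λ`, `λ ≤ min(2,a)`) then for every test function `Φ` and
`t ∈ ℝ`, `2t·Σ G·Φ − t²·Σ Φ·(HΦ) ≤ Σ G·Ψ` — the floor of the form on `Ψ − tΦ` plus the symmetry of the form. [folklore] -/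
theorem variational (V Ψ G Φ : Site d ((n + 1) * s) → ℝ) {lam : ℝ} (hlam : lam ≤ min 2 a) (hV : ∀ x, -lam ≤ V x)
    (hΨ : ∀ x, ((n : ℝ) + 1) ^ 2 * ∑ μ, (2 * Ψ x - Ψ (x + siteOf d ((n + 1) * s) (e μ)) - Ψ (x - siteOf d ((n + 1) * s) (e μ)))
      + a / ((n : ℝ) + 1) ^ d * ∑ q ∈ B n (blk n (windowMap d ((n + 1) * s) x)), Ψ (siteOf d ((n + 1) * s) q) + V x * Ψ x = G x)
    (t : ℝ) :
    2 * t * ∑ x, G x * Φ x - t ^ 2 * ∑ x, Φ x * (((n : ℝ) + 1) ^ 2 * ∑ μ, (2 * Φ x - Φ (x + siteOf d ((n + 1) * s) (e μ))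
        - Φ (x - siteOf d ((n + 1) * s) (e μ))) + a / ((n : ℝ) + 1) ^ d * ∑ q ∈ B n (blk n (windowMap d ((n + 1) * s) x)),
          Φ (siteOf d ((n + 1) * s) q) + V x * Φ x)
      ≤ ∑ x, G x * Ψ x := by
  set D : Site d ((n + 1) * s) → ℝ := fun x => Ψ x - t * Φ x with hD
  -- the floor of the form on `D`
  have hfloor : 0 ≤ ∑ x, D x * (((n : ℝ) + 1) ^ 2 * ∑ μ, (2 * D x - D (x + siteOf d ((n + 1) * s) (e μ)) - D (x - siteOf d ((n + 1) * s) (e μ)))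
      + a / ((n : ℝ) + 1) ^ d * ∑ q ∈ B n (blk n (windowMap d ((n + 1) * s) x)), D (siteOf d ((n + 1) * s) q) + V x * D x) := by
    have hc := torus_form_coercive_explicit n a s D
    have hVD : -lam * ∑ x, D x ^ 2 ≤ ∑ x, V x * D x ^ 2 := by
      rw [Finset.mul_sum]; exact Finset.sum_le_sum fun x _ => mul_le_mul_of_nonneg_right (hV x) (sq_nonneg _)
    have hS : 0 ≤ ∑ x, D x ^ 2 := Finset.sum_nonneg fun _ _ => sq_nonneg _
    have hsplit : ∑ x, D x * (((n : ℝ) + 1) ^ 2 * ∑ μ, (2 * D x - D (x + siteOf d ((n + 1) * s) (e μ)) - D (x - siteOf d ((n + 1) * s) (e μ)))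
          + a / ((n : ℝ) + 1) ^ d * ∑ q ∈ B n (blk n (windowMap d ((n + 1) * s) x)), D (siteOf d ((n + 1) * s) q) + V x * D x)
        = ∑ x, D x * (((n : ℝ) + 1) ^ 2 * ∑ μ, (2 * D x - D (x + siteOf d ((n + 1) * s) (e μ)) - D (x - siteOf d ((n + 1) * s) (e μ)))
          + a / ((n : ℝ) + 1) ^ d * ∑ q ∈ B n (blk n (windowMap d ((n + 1) * s) x)), D (siteOf d ((n + 1) * s) q))
          + ∑ x, V x * D x ^ 2 := by
      rw [← Finset.sum_add_distrib]; exact Finset.sum_congr rfl fun x _ => by ring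
    rw [hsplit]
    nlinarith [min_le_left (2 : ℝ) a]
  -- `HD = HΨ − t·HΦ = G − t·HΦ`
  have hHD : ∀ x, ((n : ℝ) + 1) ^ 2 * ∑ μ, (2 * D x - D (x + siteOf d ((n + 1) * s) (e μ)) - D (x - siteOf d ((n + 1) * s) (e μ)))
      + a / ((n : ℝ) + 1) ^ d * ∑ q ∈ B n (blk n (windowMap d ((n + 1) * s) x)), D (siteOf d ((n + 1) * s) q) + V x * D x
      = G x - t * (((n : ℝ) + 1) ^ 2 * ∑ μ, (2 * Φ x - Φ (x + siteOf d ((n + 1) * s) (e μ)) - Φ (x - siteOf d ((n + 1) * s) (e μ)))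
        + a / ((n : ℝ) + 1) ^ d * ∑ q ∈ B n (blk n (windowMap d ((n + 1) * s) x)), Φ (siteOf d ((n + 1) * s) q) + V x * Φ x) := by
    intro x
    simp only [hD]
    rw [action_sub n a s V Ψ (fun x => t * Φ x) x, hΨ x, action_smul n a s V Φ t x]
  -- the cross term by symmetry: `Σ Ψ·HΦ = Σ Φ·HΨ = Σ Φ·G`
  have hcross := action_form_symm n a s V Φ Ψ
  simp only [hΨ] at hcross
  -- expand `Σ D·HD`
  have hexp : ∑ x, D x * (G x - t * (((n : ℝ) + 1) ^ 2 * ∑ μ, (2 * Φ x - Φ (x + siteOf d ((n + 1) * s) (e μ)) - Φ (x - siteOf d ((n + 1) * s) (e μ)))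
        + a / ((n : ℝ) + 1) ^ d * ∑ q ∈ B n (blk n (windowMap d ((n + 1) * s) x)), Φ (siteOf d ((n + 1) * s) q) + V x * Φ x))
      = ∑ x, G x * Ψ x - t * ∑ x, G x * Φ x
        - t * ∑ x, Ψ x * (((n : ℝ) + 1) ^ 2 * ∑ μ, (2 * Φ x - Φ (x + siteOf d ((n + 1) * s) (e μ)) - Φ (x - siteOf d ((n + 1) * s) (e μ)))
          + a / ((n : ℝ) + 1) ^ d * ∑ q ∈ B n (blk n (windowMap d ((n + 1) * s) x)), Φ (siteOf d ((n + 1) * s) q) + V x * Φ x)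
        + t ^ 2 * ∑ x, Φ x * (((n : ℝ) + 1) ^ 2 * ∑ μ, (2 * Φ x - Φ (x + siteOf d ((n + 1) * s) (e μ)) - Φ (x - siteOf d ((n + 1) * s) (e μ)))
          + a / ((n : ℝ) + 1) ^ d * ∑ q ∈ B n (blk n (windowMap d ((n + 1) * s) x)), Φ (siteOf d ((n + 1) * s) q) + V x * Φ x) := by
    simp only [hD, Finset.mul_sum, ← Finset.sum_sub_distrib, ← Finset.sum_add_distrib]
    exact Finset.sum_congr rfl fun x _ => by ring
  simp only [hHD] at hfloor
  rw [hexp, hcross] at hfloor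
  have hsym : ∑ x, Φ x * G x = ∑ x, G x * Φ x := Finset.sum_congr rfl fun x _ => mul_comm _ _
  rw [hsym] at hfloor
  linarith

variable (ha : 0 < a) {lam Lam : ℝ} (hlam : lam ≤ min 2 a) (hLam : 0 ≤ Lam)
  (V : Site d ((n + 1) * s) → ℝ) (hV : ∀ x, -lam ≤ V x) (hV' : ∀ x, V x ≤ Lam)
  (ψ : Site d s → Site d ((n + 1) * s) → ℝ)
  (hψ : ∀ y' x, ((n : ℝ) + 1) ^ 2 * ∑ μ, (2 * ψ y' x - ψ y' (x + siteOf d ((n + 1) * s) (e μ)) - ψ y' (x - siteOf d ((n + 1) * s) (e μ)))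
      + a / ((n : ℝ) + 1) ^ d * ∑ q ∈ B n (blk n (windowMap d ((n + 1) * s) x)), ψ y' (siteOf d ((n + 1) * s) q) + V x * ψ y' x
      = if siteOf d s (blk n (windowMap d ((n + 1) * s) x)) = y' then 1 else 0)

include ha hlam hLam hV hV' hψ in
/-- **THE COARSE FLOOR — [B6] (2.76)'s TORUS TWIN WITH A BOUNDED POTENTIAL, MESH- AND VOLUME-FREE**: for `H = (n+1)²(−Δ) + a(n+1)^{−d}(block
sums) + V` with `−λ ≤ V ≤ Λ`, `λ ≤ min(2,a)`, `a > 0`, the Schur complement `T(y,y′) = (n+1)^{−d}Σ_z ψ_{y′}(σ(chart (wm y) z))` of the block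
columns `Hψ_{y′} = 𝟙[bt · = y′]` satisfies `Σ_y g y² ∕ (36^d(4d + a + Λ)) ≤ Σ_y g y·Σ_{y′} T(y,y′) g y′` for EVERY coarse `g` — the variational
inequality with the test function `t·g(bt ·)·bump` (`B6QGQLower276`'s tapered block bump read on window representatives). [folklore] -/
theorem coarse_floor (g : Site d s → ℝ) :
    1 / ((36 : ℝ) ^ d * (4 * d + a + Lam)) * ∑ y, g y ^ 2
      ≤ ∑ y, g y * ∑ y', ((((n : ℝ) + 1) ^ d)⁻¹ * ∑ z : Fin d → Fin (n + 1), ψ y' (siteOf d ((n + 1) * s) (chart n (windowMap d s y) z))) * g y' := by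
  classical
  have hvol : (0 : ℝ) < ((n : ℝ) + 1) ^ d := by positivity
  have hn : (0 : ℝ) < (n : ℝ) + 1 := by positivity
  have hd : (0 : ℝ) ≤ d := Nat.cast_nonneg d
  set Ψ : Site d ((n + 1) * s) → ℝ := fun x => ∑ y', g y' * ψ y' x with hΨdef
  set Fb : Site d ((n + 1) * s) → ℝ := fun x => F n (fun q => g (siteOf d s q)) (windowMap d ((n + 1) * s) x) with hFb
  -- (P1) `HΨ = g ∘ bt`
  have hΨ : ∀ x, ((n : ℝ) + 1) ^ 2 * ∑ μ, (2 * Ψ x - Ψ (x + siteOf d ((n + 1) * s) (e μ)) - Ψ (x - siteOf d ((n + 1) * s) (e μ)))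
      + a / ((n : ℝ) + 1) ^ d * ∑ q ∈ B n (blk n (windowMap d ((n + 1) * s) x)), Ψ (siteOf d ((n + 1) * s) q) + V x * Ψ x
      = g (siteOf d s (blk n (windowMap d ((n + 1) * s) x))) := by
    intro x
    simp only [hΨdef]
    rw [action_sum_smul n a s Finset.univ g ψ V x]
    simp only [hψ, mul_ite, mul_one, mul_zero]
    rw [Finset.sum_ite_eq, if_pos (Finset.mem_univ _)]
  -- (P2) the coarse form is `vol⁻¹·Σ_x g(bt x)·Ψ x`
  have hform : ∑ y, g y * ∑ y', ((((n : ℝ) + 1) ^ d)⁻¹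
        * ∑ z : Fin d → Fin (n + 1), ψ y' (siteOf d ((n + 1) * s) (chart n (windowMap d s y) z))) * g y'
      = (((n : ℝ) + 1) ^ d)⁻¹ * ∑ x, g (siteOf d s (blk n (windowMap d ((n + 1) * s) x))) * Ψ x := by
    rw [sum_blockLift_mul n s g Ψ, Finset.mul_sum]
    refine Finset.sum_congr rfl fun y _ => ?_
    rw [sum_B (windowMap d s y) (fun p => Ψ (siteOf d ((n + 1) * s) p))]
    have hin : ∑ y', ((((n : ℝ) + 1) ^ d)⁻¹
          * ∑ z : Fin d → Fin (n + 1), ψ y' (siteOf d ((n + 1) * s) (chart n (windowMap d s y) z))) * g y'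
        = (((n : ℝ) + 1) ^ d)⁻¹ * ∑ z : Fin d → Fin (n + 1), ∑ y', g y' * ψ y' (siteOf d ((n + 1) * s) (chart n (windowMap d s y) z)) := by
      calc ∑ y', ((((n : ℝ) + 1) ^ d)⁻¹ * ∑ z : Fin d → Fin (n + 1), ψ y' (siteOf d ((n + 1) * s) (chart n (windowMap d s y) z))) * g y'
          = ∑ y', ∑ z : Fin d → Fin (n + 1), (((n : ℝ) + 1) ^ d)⁻¹ * (g y' * ψ y' (siteOf d ((n + 1) * s) (chart n (windowMap d s y) z))) :=
            Finset.sum_congr rfl fun y' _ => by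
              rw [mul_comm, ← mul_assoc, Finset.mul_sum]
              exact Finset.sum_congr rfl fun z _ => by ring
        _ = ∑ z : Fin d → Fin (n + 1), ∑ y', (((n : ℝ) + 1) ^ d)⁻¹ * (g y' * ψ y' (siteOf d ((n + 1) * s) (chart n (windowMap d s y) z))) :=
            Finset.sum_comm
        _ = _ := by
            rw [Finset.mul_sum]
            exact Finset.sum_congr rfl fun z _ => (Finset.mul_sum _ _ _).symm
    rw [hin]
    simp only [hΨdef]
    ring
  -- (P3) variational inequality with `t₀ = 6^{−d}∕(4d + a + Λ)`
  set t₀ : ℝ := (1 / 6 : ℝ) ^ d / (4 * d + a + Lam) with ht₀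
  have ht₀0 : 0 ≤ t₀ := by positivity
  have hvar := variational n a s V Ψ (fun x => g (siteOf d s (blk n (windowMap d ((n + 1) * s) x)))) Fb hlam hV hΨ t₀
  -- (P4) the pairing; (P5) the form of the test function
  have hpair : ∑ x, g (siteOf d s (blk n (windowMap d ((n + 1) * s) x))) * Fb x = Theta1 n ^ d * ∑ y, g y ^ 2 := sum_blockLift_mul_F n s g
  have hsplit := torus_form_split n a s Fb
  have hL : ((n : ℝ) + 1) ^ 2 * ∑ μ : Fin d, ∑ x, (Fb (x + siteOf d ((n + 1) * s) (e μ)) - Fb x) ^ 2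
      ≤ 4 * d * ((n : ℝ) + 1) ^ d * ∑ y, g y ^ 2 := by
    have h1 := Finset.sum_le_sum fun μ (_ : μ ∈ (Finset.univ : Finset (Fin d))) => sum_bond_sq_le n s g μ
    rw [Finset.sum_const, Finset.card_univ, Fintype.card_fin, nsmul_eq_mul] at h1
    exact (mul_le_mul_of_nonneg_left h1 (by positivity)).trans (le_of_eq (by field_simp))
  have hB : a / ((n : ℝ) + 1) ^ d * ∑ y : Site d s, (∑ z : Fin d → Fin (n + 1), Fb (siteOf d ((n + 1) * s) (chart n (windowMap d s y) z))) ^ 2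
      ≤ a * ((n : ℝ) + 1) ^ d * ∑ y, g y ^ 2 := by
    simp only [hFb, blockSum_F n s g, mul_pow, ← Finset.sum_mul]
    have hΘ : Theta1 n ^ d ≤ ((n : ℝ) + 1) ^ d := pow_le_pow_left₀ (Theta1_nonneg n) ((div_le_one hn).1 (Theta1_div_le n)) d
    have hS : 0 ≤ ∑ y, g y ^ 2 := Finset.sum_nonneg fun _ _ => sq_nonneg _
    rw [div_mul_eq_mul_div, div_le_iff₀ hvol]
    have : (Theta1 n ^ d) ^ 2 ≤ ((n : ℝ) + 1) ^ d * ((n : ℝ) + 1) ^ d := by nlinarith [pow_nonneg (Theta1_nonneg n) d]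
    nlinarith [mul_le_mul_of_nonneg_left this (mul_nonneg ha.le hS)]
  have hVt : ∑ x, V x * (Fb x * Fb x) ≤ Lam * ((n : ℝ) + 1) ^ d * ∑ y, g y ^ 2 := by
    have h1 : ∑ x, V x * (Fb x * Fb x) ≤ ∑ x, Lam * Fb x ^ 2 :=
      Finset.sum_le_sum fun x _ => by rw [← sq]; exact mul_le_mul_of_nonneg_right (hV' x) (sq_nonneg _)
    rw [← Finset.mul_sum] at h1
    exact h1.trans (by rw [mul_assoc]; exact mul_le_mul_of_nonneg_left (sum_F_sq_le n s g) hLam)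
  have hformF : ∑ x, Fb x * (((n : ℝ) + 1) ^ 2 * ∑ μ, (2 * Fb x - Fb (x + siteOf d ((n + 1) * s) (e μ))
        - Fb (x - siteOf d ((n + 1) * s) (e μ))) + a / ((n : ℝ) + 1) ^ d * ∑ q ∈ B n (blk n (windowMap d ((n + 1) * s) x)),
          Fb (siteOf d ((n + 1) * s) q) + V x * Fb x)
      ≤ (4 * d + a + Lam) * ((n : ℝ) + 1) ^ d * ∑ y, g y ^ 2 := by
    have e : ∑ x, Fb x * (((n : ℝ) + 1) ^ 2 * ∑ μ, (2 * Fb x - Fb (x + siteOf d ((n + 1) * s) (e μ))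
        - Fb (x - siteOf d ((n + 1) * s) (e μ))) + a / ((n : ℝ) + 1) ^ d * ∑ q ∈ B n (blk n (windowMap d ((n + 1) * s) x)),
          Fb (siteOf d ((n + 1) * s) q) + V x * Fb x)
      = ∑ x, Fb x * (((n : ℝ) + 1) ^ 2 * ∑ μ, (2 * Fb x - Fb (x + siteOf d ((n + 1) * s) (e μ))
        - Fb (x - siteOf d ((n + 1) * s) (e μ))) + a / ((n : ℝ) + 1) ^ d * ∑ q ∈ B n (blk n (windowMap d ((n + 1) * s) x)),
          Fb (siteOf d ((n + 1) * s) q)) + ∑ x, V x * (Fb x * Fb x) := by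
      rw [← Finset.sum_add_distrib]; exact Finset.sum_congr rfl fun x _ => by ring
    rw [e, hsplit]
    linarith
  -- (P6) the scalar optimisation at `t₀ = σ∕D`, `σ = 6^{−d}`, `D = 4d + a + Λ`
  have hΘlo : ((n : ℝ) + 1) ^ d * (1 / 6 : ℝ) ^ d ≤ Theta1 n ^ d := by
    rw [← mul_pow]
    refine pow_le_pow_left₀ (by positivity) ?_ d
    have := Theta1_div_ge n; rw [le_div_iff₀ hn] at this; linarith
  have hS : 0 ≤ ∑ y, g y ^ 2 := Finset.sum_nonneg fun _ _ => sq_nonneg _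
  set σ : ℝ := (1 / 6 : ℝ) ^ d with hσ
  have hσσ : σ * σ = 1 / (36 : ℝ) ^ d := by rw [hσ, ← mul_pow, show (1 / 6 : ℝ) * (1 / 6) = 1 / 36 by norm_num, one_div_pow]
  rw [hpair] at hvar
  have h1 : 2 * t₀ * (((n : ℝ) + 1) ^ d * σ * ∑ y, g y ^ 2) ≤ 2 * t₀ * (Theta1 n ^ d * ∑ y, g y ^ 2) :=
    mul_le_mul_of_nonneg_left (mul_le_mul_of_nonneg_right hΘlo hS) (by positivity)
  have h2 := mul_le_mul_of_nonneg_left hformF (sq_nonneg t₀)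
  have h3 : ((n : ℝ) + 1) ^ d * (1 / ((36 : ℝ) ^ d * (4 * d + a + Lam)) * ∑ y, g y ^ 2)
      = 2 * t₀ * (((n : ℝ) + 1) ^ d * σ * ∑ y, g y ^ 2) - t₀ ^ 2 * ((4 * d + a + Lam) * ((n : ℝ) + 1) ^ d * ∑ y, g y ^ 2) := by
    rw [show (1 : ℝ) / ((36 : ℝ) ^ d * (4 * d + a + Lam)) = σ * σ / (4 * d + a + Lam) by
      rw [← one_div_mul_one_div, ← hσσ]; ring, ht₀]
    field_simp
    ring
  have key : ((n : ℝ) + 1) ^ d * (1 / ((36 : ℝ) ^ d * (4 * d + a + Lam)) * ∑ y, g y ^ 2)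
      ≤ ∑ x, g (siteOf d s (blk n (windowMap d ((n + 1) * s) x))) * Ψ x := by
    rw [h3]; linarith
  rw [hform, inv_mul_eq_div]
  exact (le_div_iff₀' hvol).2 key

end Floor

/-! ## §3. THE END: the next-scale Hessian is exponentially local — every field of the two-sided class, every mesh, every volume -/

/-- **HEADLINE — THE NEXT-SCALE HESSIAN OF THE TORUS ROAD IS EXPONENTIALLY LOCAL, UNCONDITIONALLY.**  Fix the dimension `d`, the block
coupling `a > 0`, a potential floor `λ < min(2,a)` and ceiling `Λ ≥ 0`.  THERE ARE `c₁, δ₁ > 0`, depending on NOTHING ELSE, such that on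
EVERY pair of tori `(ℤ∕(n+1)s)^d → (ℤ∕s)^d` (every mesh `n`, every period `s`), for EVERY diagonal potential `−λ ≤ V ≤ Λ` (the Hessian
`At + diag(u′∘φ)` of the torus action at ANY field `φ` of the two-sided class `−λ ≤ u′ ≤ Λ`) and the block columns `ψ_{y′}` of `H⁻¹`
(`Hψ_{y′} = 𝟙[bt · = y′]`), the inverse of the Schur complement `T(y,y′) = (n+1)^{−d}Σ_z ψ_{y′}(σ(chart (wm y) z))` — the road's
next-scale Hessian `W″ = (n+1)^d T⁻¹` up to the block volume — satisfies `|T⁻¹(y,y′)| ≤ c₁·e^{−δ₁ρ_s(y,y′)}`.  (131) `exists_rate` ∘ (134)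
`schur_inverse_decay` ∘ §2 `coarse_floor`.  The located «mesh-UNIFORM locality» of the convex torus road, for its central next-scale
object, with no hypothesis left. [folklore] -/
theorem nextScale_hessian_local (a : ℝ) (ha : 0 < a) {lam Lam : ℝ} (hm0 : 0 < min 2 a - lam) (hLam : 0 ≤ Lam) :
    ∃ c₁ δ₁ : ℝ, 0 < c₁ ∧ 0 < δ₁ ∧ ∀ (n s : ℕ) [NeZero s] (V : Site d ((n + 1) * s) → ℝ), (∀ x, -lam ≤ V x) → (∀ x, V x ≤ Lam) →
      ∀ ψ : Site d s → Site d ((n + 1) * s) → ℝ,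
      (∀ y' x, ((n : ℝ) + 1) ^ 2 * ∑ μ, (2 * ψ y' x - ψ y' (x + siteOf d ((n + 1) * s) (e μ)) - ψ y' (x - siteOf d ((n + 1) * s) (e μ)))
        + a / ((n : ℝ) + 1) ^ d * ∑ q ∈ B n (blk n (windowMap d ((n + 1) * s) x)), ψ y' (siteOf d ((n + 1) * s) q) + V x * ψ y' x
        = if siteOf d s (blk n (windowMap d ((n + 1) * s) x)) = y' then 1 else 0) →
      ∀ y y' : Site d s,
        |(Matrix.of fun y y' : Site d s =>
            (((n : ℝ) + 1) ^ d)⁻¹ * ∑ z : Fin d → Fin (n + 1), ψ y' (siteOf d ((n + 1) * s) (chart n (windowMap d s y) z)))⁻¹ y y'|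
          ≤ c₁ * exp (-(δ₁ * ∑ i, (((y i - y' i).valMinAbs.natAbs : ℕ) : ℝ))) := by
  obtain ⟨κ, hκ0, hκ1, hκm⟩ := SupTorusHessianCombesThomas.exists_rate (d := d) a ha.le hm0
  have hm : 0 < min 2 a - lam - 2 * d * κ ^ 2 - a * (exp (2 * d * κ) - 1) := by linarith
  have hd : (0 : ℝ) ≤ d := Nat.cast_nonneg d
  have hγ : 0 < 1 / ((36 : ℝ) ^ d * (4 * d + a + Lam)) := by positivity
  obtain ⟨c₁, δ₁, hc₁, hδ₁, H⟩ := schur_inverse_decay (d := d) a ha.le hκ0 hκ1 hm hγ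
  exact ⟨c₁, δ₁, hc₁, hδ₁, fun n s _ V hV hV' ψ hψ y y' =>
    H n s V hV ψ hψ (coarse_floor n a s ha (by linarith) hLam V hV hV' ψ hψ) y y'⟩

/-! ## §4. Toy -/

/-- Toy (`d = 0`, `a = 1`, `λ = 0`, `Λ = 0`): the headline's hypotheses are inhabited, so the constants exist. -/
example : ∃ c₁ δ₁ : ℝ, 0 < c₁ ∧ 0 < δ₁ :=
  let ⟨c₁, δ₁, hc₁, hδ₁, _⟩ := nextScale_hessian_local (d := 0) 1 one_pos (lam := 0) (Lam := 0) (by norm_num) le_rfl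
  ⟨c₁, δ₁, hc₁, hδ₁⟩

end Summit.QuantumFields.BalabanUV.T4Continuum.NE7b.SupTorusCoarseFloor
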